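import Mathlib.CategoryTheory.Comma.Over.Basic
import Literature.AlgebraicGeometry.Frobenioids.Thm36SubProofs2
import Literature.AlgebraicGeometry.Frobenioids.Thm36SubProofs
import HarnessLib

/-!
# Frobenioids II, Theorem 3.6 (x) for `C^ℝ := C^rlf`: the realification of the archimedean Frobenioid is slim

Mochizuki, *The geometry of Frobenioids II*, Kyushu J. Math. **62** (2008) 401–460, Theorem 3.6 (x) p. 38:
"If `D` is slim, and `Λ ∈ {ℤ, ℝ}`, then `F` is also slim", here for `F = C^ℝ := C^rlf` (Example 3.3 (ii)
p. 28), by the argument of [FrdI] Prop. 1.13 (i)/(iii) pp. 39–40 run in the model Frobenioid ([FrdI] Thm. 5.2)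
`C^rlf` of `(Φ^rlf, ℝ · Φ^birat)`: a natural automorphism `α` of `C^rlf_A → C^rlf` induces, through the
canonical lifts `(E, g^*a) → (A_D, a)` of the arrows `g : E → A_D` of `D_{A_D}`, a natural automorphism of
`D_{A_D} → D`, trivial since `D` is slim (Step 1); so every component of `α` is a base-identity linear
automorphism, i.e. a unit, and `O^×` of `C^rlf` is trivial (`Thm36Sub.rlf_unitsSubgroup_eq_bot`, Thm. 3.6
(v)(c)) (Step 2).  Companion #4 of `Thm36Sub.lean` (abc-iut cell, L1 row M13); closes the slot
`Thm36Sub.x_R`.  The auxiliary lifts are definitions; no statement of the paper is re-typed; no side taken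
on [IUTchIII] Cor. 3.12.
-/

noncomputable section

namespace Literature.AlgebraicGeometry.Frobenioids

open CategoryTheory Opposite Literature.AnabelianGeometry.EtaleTheta
open scoped NNReal

universe w' v' u' v u

/-! ### Two bookkeeping identities in a model Frobenioid -/

namespace ModelFrobenioid

variable {D' : Type u'} [Category.{v'} D'] {Φ' B' : D'ᵒᵖ ⥤ CommMonCat.{w'}} {DivB' : B' ⟶ monoidGp Φ'}
  {X Y Z : ModelFrobenioid Φ' B' DivB'}

/-- Post-composing with a morphism `(1, g, 0, 1)` does not change `Div`. [cite: MochizukiFrdI2008, Thm. 5.2(i) p.100] -/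
theorem div_comp_of_eq_one (φ : X ⟶ Y) (ψ : Y ⟶ Z) (h₁ : degFr ψ = 1) (h₂ : div ψ = 1) :
    div (φ ≫ ψ) = div φ := by
  rw [div_comp, h₁, h₂, map_one, one_mul, PNat.one_coe, pow_one]

/-- Post-composing with a morphism `(1, g, 0, 1)` does not change `u_φ`. [cite: MochizukiFrdI2008, Thm. 5.2(i) p.100] -/
theorem unit_comp_of_eq_one (φ : X ⟶ Y) (ψ : Y ⟶ Z) (h₁ : degFr ψ = 1) (h₂ : unit ψ = 1) :
    unit (φ ≫ ψ) = unit φ := by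
  rw [unit_comp, h₁, h₂, map_one, one_mul, PNat.one_coe, pow_one]

end ModelFrobenioid

namespace ArchFrd

namespace Thm36Sub

variable {D : Type u} [Category.{v} D] (π : D ⥤ D0)

/-! ### The canonical lifts `(E, g^* a) → (A_D, a)` of the arrows of `D_{A_D}` -/

/-- The LIFT of `g : E → A_D` to an object of `C^rlf` over `E`: `(E, g^* a)` for `A = (A_D, a)`
([FrdI] Prop. 1.13 (i) pattern; here `g^* a = a`, the pull-backs of `Φ^rlf` being identities).
[cite: MochizukiFrdI2008, Prop. 1.13 (i) pp.39-40] -/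
def liftObj (A : rlfCat π) (g : Over A.base) : rlfCat π := ⟨g.left, pullGp _ g.hom A.cls⟩

/-- The LIFTED ARROW `(1, g, 0, 1) : (E, g^* a) → (A_D, a)` of `C^rlf` over `g`. [cite: MochizukiFrdI2008, Prop. 1.13 (i) pp.39-40] -/
def liftHom (A : rlfCat π) (g : Over A.base) : liftObj π A g ⟶ A :=
  ⟨1, g.hom, 1, 1, by rw [PNat.one_coe, pow_one, map_one, mul_one, map_one, mul_one]; rfl⟩

/-- The LIFT `(1, k, 0, 1) : (E', g'^* a) → (E, g^* a)` of an arrow `k : g' → g` of `D_{A_D}`.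
[cite: MochizukiFrdI2008, Prop. 1.13 (i) pp.39-40] -/
def liftMap (A : rlfCat π) {g' g : Over A.base} (k : g' ⟶ g) : liftObj π A g' ⟶ liftObj π A g :=
  ⟨1, k.left, 1, 1, by
    rw [PNat.one_coe, pow_one, map_one, mul_one, map_one, mul_one]
    change pullGp _ g'.hom A.cls = pullGp _ k.left (pullGp _ g.hom A.cls)
    rw [← pullGp_comp, Over.w k]⟩

/-- The lift of `k` is an arrow over `A`: `liftMap k ; liftHom g = liftHom g'`. [cite: MochizukiFrdI2008, Prop. 1.13 (i) pp.39-40] -/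
theorem liftMap_comp_liftHom (A : rlfCat π) {g' g : Over A.base} (k : g' ⟶ g) :
    liftMap π A k ≫ liftHom π A g = liftHom π A g' := by
  apply ModelFrobenioid.hom_ext
  · rfl
  · exact Over.w k
  · exact ModelFrobenioid.div_comp_of_eq_one _ _ rfl rfl
  · exact ModelFrobenioid.unit_comp_of_eq_one _ _ rfl rfl

/-- The lift of `k` as an arrow of `C^rlf_A`. [cite: MochizukiFrdI2008, Prop. 1.13 (i) pp.39-40] -/
def liftOver (A : rlfCat π) {g' g : Over A.base} (k : g' ⟶ g) :
    Over.mk (liftHom π A g') ⟶ Over.mk (liftHom π A g) :=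
  Over.homMk (liftMap π A k) (liftMap_comp_liftHom π A k)

/-! ### Step 1: a natural automorphism of `C^rlf_A → C^rlf` lies over the identity of `D` -/

/-- The natural automorphism of `D_{A_D} → D` induced by a natural automorphism `α` of `C^rlf_A → C^rlf`
through the lifts. [cite: MochizukiFrdI2008, Prop. 1.13 (i) pp.39-40] -/
def baseAuto (A : rlfCat π) (α : Over.forget A ≅ Over.forget A) :
    Over.forget A.base ≅ Over.forget A.base :=
  NatIso.ofComponents
    (fun g => (PreFrobenioid.baseFunctor (rlfStr π)).mapIso (α.app (Over.mk (liftHom π A g)))) (by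
    intro g' g k
    exact congrArg ModelFrobenioid.baseMap (α.hom.naturality (liftOver π A k)))

/-- `D` slim ⇒ the lifted components of `α` have trivial base. [cite: MochizukiFrdI2008, Prop. 1.13 (i) pp.39-40] -/
theorem baseMap_app_liftHom (hD : IsSlim D) (A : rlfCat π) (α : Over.forget A ≅ Over.forget A)
    (g : Over A.base) : ModelFrobenioid.baseMap (α.app (Over.mk (liftHom π A g))).hom = 𝟙 g.left :=
  congrArg (fun γ : Over.forget A.base ≅ Over.forget A.base => γ.hom.app g)
    (hD.isRigid_forget A.base (baseAuto π A α))

/-- The VERTICAL arrow `(n, id, Div f, u_f) : B → (B_D, Base(f)^* a)` through which `f = (n, Base f, Div f, u_f) :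
B → A` factors. [cite: MochizukiFrdI2008, Prop. 1.13 (i) pp.39-40] -/
def vert (A : rlfCat π) (f : Over A) : f.left ⟶ liftObj π A (Over.mk (ModelFrobenioid.baseMap f.hom)) :=
  ⟨ModelFrobenioid.degFr f.hom, 𝟙 _, ModelFrobenioid.div f.hom, ModelFrobenioid.unit f.hom, by
    refine (ModelFrobenioid.rel f.hom).trans ?_
    change _ = pullGp _ (𝟙 f.left.base) (pullGp _ (ModelFrobenioid.baseMap f.hom) A.cls) * _
    rw [pullGp_id]⟩

/-- `vert f ; liftHom (Base f) = f`. [cite: MochizukiFrdI2008, Prop. 1.13 (i) pp.39-40] -/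
theorem vert_comp_liftHom (A : rlfCat π) (f : Over A) :
    vert π A f ≫ liftHom π A (Over.mk (ModelFrobenioid.baseMap f.hom)) = f.hom := by
  apply ModelFrobenioid.hom_ext
  · exact one_mul _
  · exact Category.id_comp _
  · exact ModelFrobenioid.div_comp_of_eq_one _ _ rfl rfl
  · exact ModelFrobenioid.unit_comp_of_eq_one _ _ rfl rfl

/-- **Step 1** ([FrdI] Prop. 1.13 (i) for `C^rlf`): for `D` slim, every component of a natural
automorphism of `C^rlf_A → C^rlf` lies over the identity of `D`. [cite: MochizukiFrdI2008, Prop. 1.13 (i) pp.39-40] -/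
theorem baseMap_app_eq_id (hD : IsSlim D) (A : rlfCat π) (α : Over.forget A ≅ Over.forget A) (f : Over A) :
    ModelFrobenioid.baseMap (α.app f).hom = 𝟙 f.left.base := by
  have hnat := α.hom.naturality (Over.homMk (vert π A f) (vert_comp_liftHom π A f) :
    f ⟶ Over.mk (liftHom π A (Over.mk (ModelFrobenioid.baseMap f.hom))))
  have h2 : ModelFrobenioid.baseMap (vert π A f) ≫
        ModelFrobenioid.baseMap (α.app (Over.mk (liftHom π A (Over.mk (ModelFrobenioid.baseMap f.hom))))).hom =
      ModelFrobenioid.baseMap (α.app f).hom ≫ ModelFrobenioid.baseMap (vert π A f) :=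
    congrArg ModelFrobenioid.baseMap hnat
  have h1 := baseMap_app_liftHom π hD A α (Over.mk (ModelFrobenioid.baseMap f.hom))
  have e1 : ModelFrobenioid.baseMap (α.app f).hom =
      ModelFrobenioid.baseMap (α.app f).hom ≫ ModelFrobenioid.baseMap (vert π A f) :=
    (Category.comp_id _).symm
  have e2 : ModelFrobenioid.baseMap (vert π A f) ≫
        ModelFrobenioid.baseMap (α.app (Over.mk (liftHom π A (Over.mk (ModelFrobenioid.baseMap f.hom))))).hom =
      𝟙 f.left.base := by
    rw [h1]
    exact Category.comp_id _
  exact e1.trans (h2.symm.trans e2)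

/-! ### Step 2: units are trivial, so `α = 1`; Theorem 3.6 (x) for `C^ℝ` -/

/-- **[FrdI] Prop. 1.13 (iii) for `C^rlf`**: for `D` slim, every component of a natural automorphism of
`C^rlf_A → C^rlf` is the identity (it is a unit by Step 1, and `O^×` of `C^rlf` is trivial, Thm. 3.6 (v)(c)).
[cite: MochizukiFrdII2008, Thm 3.6 (x) p.38] -/
theorem app_eq_one (hD : IsSlim D) (A : rlfCat π) (α : Over.forget A ≅ Over.forget A) (f : Over A) :
    (α.app f : Aut f.left) = (1 : Aut f.left) := by
  have hmem : (α.app f : Aut f.left) ∈ PreFrobenioid.unitsSubgroup (rlfStr π) f.left :=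
    ⟨baseMap_app_eq_id π hD A α f, (ModelFrobenioid.degFr_hom_eq_one (α.app f)).1⟩
  rw [rlf_unitsSubgroup_eq_bot] at hmem
  exact hmem

/-- **Thm. 3.6 (x) for `C^ℝ = C^rlf`** (p. 38; PROVED over any base `π : D → D₀`): "If `D` is slim, and
`Λ ∈ {ℤ, ℝ}`, then `F` is also slim", `Λ = ℝ`, `F = C^rlf` — closes the slot `Thm36Sub.x_R` (the `ℝ`-conjunct
of the instance `Thm36x_CA` over THE realification). [cite: MochizukiFrdII2008, Thm 3.6 (x) p.38] -/
theorem x_R_holds : Literature.AlgebraicGeometry.Frobenioids.ArchFrd.Thm36Sub.x_R π := by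
  intro hD _
  refine ⟨fun A α => ?_⟩
  apply Iso.ext
  apply NatTrans.ext
  funext f
  exact congrArg Iso.hom (app_eq_one π hD A α f)

end Thm36Sub

end ArchFrd

end Literature.AlgebraicGeometry.Frobenioids
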